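import Mathlib.Algebra.Group.Submonoid.Operations
import Mathlib.Algebra.Order.Field.Rat
import Mathlib.Data.NNRat.Lemmas
import Literature.AlgebraicGeometry.Frobenioids.Monoids
import Literature.AlgebraicGeometry.Frobenioids.MonoidFunctors
import Literature.AlgebraicGeometry.Frobenioids.MonoidRealification
import Literature.AlgebraicGeometry.Frobenioids.MonoidTransport
import Literature.AlgebraicGeometry.Frobenioids.PerfectionDivisorial
import HarnessLib

/-!
# Frobenioids I, §0: primes of the perfection, `(M^pf)_𝔮 ≅ (M_𝔭)^pf`, perfections of monoprime monoids

Mochizuki, *The geometry of Frobenioids I*, Kyushu J. Math. **62** (2008), §0 "Monoids", kurims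
pp. 10–12 [cite: MochizukiFrdI2008, §0 pp.10-12].  For a sharp monoid `M`:

* the bijection `Prime(M) ⥲ Prime(M^pf)` of p. 12 as an `Equiv` (`Primes.perfectionEquiv`; the
  tree's `primes_equiv_primes_perfection` only asserts its existence), with the description of the
  transported subset: `a^{1/n} ∈ 𝔮 ⟺ a ∈ 𝔭`;
* `(M^pf)_𝔮 ≅ (M_𝔭)^pf`: the submonoid of `M^pf` generated by the prime `𝔮` corresponding to `𝔭`
  is the perfection of `M_𝔭` (`Primes.perfectionSubmonoidEquiv`);
* the perfection of a `ℤ`- (resp. `ℚ`-, `ℝ`-) monoprime monoid is `ℚ`- (resp. `ℚ`-, `ℝ`-) monoprime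
  (`(ℤ_{≥0})^pf ≅ ℚ_{≥0}`; `ℚ_{≥0}`, `ℝ_{≥0}` are perfect), hence: if every `M_𝔭` is monoprime then
  every `(M^pf)_𝔮` is monoprime and every `M^rlf_𝔮 = (M^pf)_𝔮 ⊗ ℝ_{≥0}` is `ℝ`-monoprime — the
  standing situation of Def. 2.4 (i) (p. 47) for a perf-factorial `M`.

Multiplicative notation as in `Monoids.lean`; no statement of the paper is strengthened.
-/

noncomputable section

namespace Literature.AlgebraicGeometry.Frobenioids

open Function

universe u

variable {M : Type u} [CommMonoid M]

namespace Perfection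

/-- `a^{1/n} · b^{1/n} = (a b)^{1/n}` in `M^pf`. [cite: MochizukiFrdI2008, §0 p.11] -/
theorem mk_mul_mk_same (a b : M) (n : ℕ+) : mk a n * mk b n = mk (a * b) n := by
  rw [mk_mul_mk, ← mul_pow, mk_pow_mul]

/-- For sharp `M`: `a^{1/n} ≠ 1` iff `a ≠ 1`. [cite: MochizukiFrdI2008, §0 p.11] -/
theorem mk_ne_one_iff_of_isSharp (hM : IsSharp M) {a : M} {n : ℕ+} : mk a n ≠ 1 ↔ a ≠ 1 :=
  not_congr (mk_eq_one_iff_of_isSharp hM)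

/-- For sharp `M`: `a^{1/n}` is primary in `M^pf` iff `a` is primary in `M`.
[cite: MochizukiFrdI2008, §0 p.12] -/
theorem isPrimary_mk_iff (hM : IsSharp M) {a : M} {n : ℕ+} : IsPrimary (mk a n) ↔ IsPrimary a := by
  rw [← isPrimary_of_iff hM]
  constructor
  · intro h
    exact h.of_precsim (mk_precsim_of a n).2
      (by rw [of_apply]; exact (mk_ne_one_iff_of_isSharp hM).mpr ((mk_ne_one_iff_of_isSharp hM).mp h.1))
  · intro h
    exact h.of_precsim (mk_precsim_of a n).1
      ((mk_ne_one_iff_of_isSharp hM).mpr ((mk_ne_one_iff_of_isSharp hM (n := 1)).mp h.1))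

end Perfection

namespace Primes

/-- The map `Prime(M) → Prime(M^pf)` induced by `M → M^pf` (§0 p. 12; `M` sharp).
[cite: MochizukiFrdI2008, §0 p.12] -/
def toPerfection (hM : IsSharp M) : Primes M → Primes (Perfection M) :=
  Quotient.map (fun a => ⟨Perfection.of M a, (Perfection.isPrimary_of_iff hM).mpr a.2⟩)
    fun _ _ h => Precsim.map (Perfection.of M) h

/-- `toPerfection` on the class of a primary element. [cite: MochizukiFrdI2008, §0 p.12] -/
theorem toPerfection_mk (hM : IsSharp M) (a : M) (h : IsPrimary a)
    (h' : IsPrimary (Perfection.of M a)) :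
    toPerfection hM (Quotient.mk (primarySetoid M) ⟨a, h⟩) =
      Quotient.mk (primarySetoid (Perfection M)) ⟨Perfection.of M a, h'⟩ := rfl

/-- `Prime(M) → Prime(M^pf)` is a bijection (§0 p. 12). [cite: MochizukiFrdI2008, §0 p.12] -/
theorem toPerfection_bijective (hM : IsSharp M) : Bijective (toPerfection hM) := by
  constructor
  · intro p q hpq
    induction p using Quotient.inductionOn with
    | h a =>
      induction q using Quotient.inductionOn with
      | h b => exact Quotient.sound (Perfection.of_precsim_of_iff.mp (Quotient.exact hpq))
  · intro q
    induction q using Quotient.inductionOn with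
    | h x =>
      obtain ⟨x, hx⟩ := x
      obtain ⟨⟨a, k⟩, rfl⟩ := Perfection.mk_surjective x
      have ha : IsPrimary a := (Perfection.isPrimary_mk_iff hM).mp hx
      refine ⟨Quotient.mk _ ⟨a, ha⟩, ?_⟩
      rw [toPerfection_mk hM a ha ((Perfection.isPrimary_of_iff hM).mpr ha)]
      exact Quotient.sound (Perfection.mk_precsim_of a k).2

/-- **`Prime(M) ≅ Prime(M^pf)`** (§0 p. 12; `M` sharp), as an equivalence. [cite: MochizukiFrdI2008, §0 p.12] -/
def perfectionEquiv (hM : IsSharp M) : Primes M ≃ Primes (Perfection M) :=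
  Equiv.ofBijective _ (toPerfection_bijective hM)

/-- `perfectionEquiv` on the class of a primary element. [cite: MochizukiFrdI2008, §0 p.12] -/
theorem perfectionEquiv_mk (hM : IsSharp M) (a : M) (h : IsPrimary a)
    (h' : IsPrimary (Perfection.of M a)) :
    perfectionEquiv hM (Quotient.mk (primarySetoid M) ⟨a, h⟩) =
      Quotient.mk (primarySetoid (Perfection M)) ⟨Perfection.of M a, h'⟩ := rfl

/-- The class of `a^{1/n}` is the class of `a` (they are `≼`-equivalent). [cite: MochizukiFrdI2008, §0 p.12] -/
theorem mk_mk_eq_perfectionEquiv_mk (hM : IsSharp M) (a : M) (n : ℕ+) (h : IsPrimary (Perfection.mk a n))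
    (ha : IsPrimary a) :
    Quotient.mk (primarySetoid (Perfection M)) ⟨Perfection.mk a n, h⟩ =
      perfectionEquiv hM (Quotient.mk (primarySetoid M) ⟨a, ha⟩) := by
  rw [perfectionEquiv_mk hM a ha ((Perfection.isPrimary_of_iff hM).mpr ha)]
  exact Quotient.sound (Perfection.mk_precsim_of a n).1

/-- **The transported subset**: `a^{1/n} ∈ 𝔮 ⟺ a ∈ 𝔭` for `𝔮` the prime of `M^pf` corresponding
to `𝔭` (§0 p. 12: `Primary(M^pf) = {a | ∃ n, n · a ∈ Primary(M)}`). [cite: MochizukiFrdI2008, §0 p.12] -/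
theorem mk_mem_carrier_perfectionEquiv_iff (hM : IsSharp M) (𝔭 : Primes M) (a : M) (n : ℕ+) :
    Perfection.mk a n ∈ (perfectionEquiv hM 𝔭).carrier ↔ a ∈ 𝔭.carrier := by
  constructor
  · rintro ⟨h, h𝔮⟩
    have ha : IsPrimary a := (Perfection.isPrimary_mk_iff hM).mp h
    refine ⟨ha, (perfectionEquiv hM).injective ?_⟩
    rw [← mk_mk_eq_perfectionEquiv_mk hM a n h ha, h𝔮]
  · rintro ⟨ha, rfl⟩
    exact ⟨(Perfection.isPrimary_mk_iff hM).mpr ha, mk_mk_eq_perfectionEquiv_mk hM a n _ ha⟩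

/-- `a^{1/n} ∈ (M^pf)_𝔮` for `a ∈ M_𝔭`. [cite: MochizukiFrdI2008, §0 p.12] -/
theorem mk_mem_submonoid_perfectionEquiv (hM : IsSharp M) (𝔭 : Primes M) {a : M}
    (ha : a ∈ 𝔭.submonoid) (n : ℕ+) : Perfection.mk a n ∈ (perfectionEquiv hM 𝔭).submonoid := by
  induction ha using Submonoid.closure_induction with
  | mem x hx =>
    exact Submonoid.subset_closure ((mk_mem_carrier_perfectionEquiv_iff hM 𝔭 x n).mpr hx)
  | one => rw [Perfection.mk_one]; exact Submonoid.one_mem _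
  | mul x y _ _ hx hy =>
    rw [← Perfection.mk_mul_mk_same]
    exact Submonoid.mul_mem _ hx hy

/-- The image of `(M_𝔭)^pf → M^pf` is `(M^pf)_𝔮`. [cite: MochizukiFrdI2008, §0 p.12] -/
theorem mrange_map_subtype (hM : IsSharp M) (𝔭 : Primes M) :
    MonoidHom.mrange (Perfection.map 𝔭.submonoid.subtype) = (perfectionEquiv hM 𝔭).submonoid := by
  apply le_antisymm
  · rintro _ ⟨z, rfl⟩
    obtain ⟨⟨a, n⟩, rfl⟩ := Perfection.mk_surjective z
    exact mk_mem_submonoid_perfectionEquiv hM 𝔭 a.2 n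
  · rw [Primes.submonoid, Submonoid.closure_le]
    intro x hx
    obtain ⟨⟨a, n⟩, rfl⟩ := Perfection.mk_surjective x
    have ha : a ∈ 𝔭.carrier := (mk_mem_carrier_perfectionEquiv_iff hM 𝔭 a n).mp hx
    exact ⟨Perfection.mk ⟨a, Submonoid.subset_closure ha⟩ n, rfl⟩

/-- **`(M_𝔭)^pf ≅ (M^pf)_𝔮`** for the prime `𝔮` of `M^pf` corresponding to `𝔭` (§0 p. 12; stated
with an equation `h` so that no transport of the index is needed downstream).
[cite: MochizukiFrdI2008, §0 p.12] -/
def perfectionSubmonoidEquiv (hM : IsSharp M) (𝔭 : Primes M) (𝔮 : Primes (Perfection M))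
    (h : perfectionEquiv hM 𝔭 = 𝔮) : Perfection ↥𝔭.submonoid ≃* ↥𝔮.submonoid :=
  MulEquiv.ofBijective
    ((Perfection.map 𝔭.submonoid.subtype).codRestrict 𝔮.submonoid fun z => by
      rw [← h, ← mrange_map_subtype hM 𝔭]
      exact ⟨z, rfl⟩)
    ⟨fun x y hxy => Perfection.map_injective _ Subtype.val_injective (congrArg Subtype.val hxy),
      fun y => by
        have hy : (y : Perfection M) ∈ MonoidHom.mrange (Perfection.map 𝔭.submonoid.subtype) := by
          rw [mrange_map_subtype hM 𝔭, h]
          exact y.2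
        obtain ⟨z, hz⟩ := hy
        exact ⟨z, Subtype.ext hz⟩⟩

/-- `perfectionSubmonoidEquiv` on classes: `(a^{1/n}) ↦ a^{1/n}`. [cite: MochizukiFrdI2008, §0 p.12] -/
@[simp] theorem coe_perfectionSubmonoidEquiv_mk (hM : IsSharp M) (𝔭 : Primes M)
    (𝔮 : Primes (Perfection M)) (h : perfectionEquiv hM 𝔭 = 𝔮) (a : ↥𝔭.submonoid) (n : ℕ+) :
    (perfectionSubmonoidEquiv hM 𝔭 𝔮 h (Perfection.mk a n) : Perfection M) = Perfection.mk (a : M) n :=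
  rfl

end Primes

/-! ### Perfections of monoprime monoids -/

section MonoprimePerfection

/-- `ℚ_{≥0}` is perfect: multiplication by `n ≥ 1` is bijective. [cite: MochizukiFrdI2008, §0 p.11] -/
theorem isPerfect_multiplicative_nnrat : IsPerfect (Multiplicative ℚ≥0) := by
  refine ⟨fun n hn => ?_⟩
  have hn' : (n : ℚ≥0) ≠ 0 := Nat.cast_ne_zero.mpr hn.ne'
  constructor
  · intro x y hxy
    have h : n • Multiplicative.toAdd x = n • Multiplicative.toAdd y := by
      rw [← toAdd_pow, ← toAdd_pow]; exact congrArg _ hxy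
    rw [nsmul_eq_mul, nsmul_eq_mul] at h
    exact Multiplicative.toAdd.injective (mul_left_cancel₀ hn' h)
  · intro y
    refine ⟨Multiplicative.ofAdd (Multiplicative.toAdd y / n), ?_⟩
    dsimp only
    rw [← ofAdd_nsmul, nsmul_eq_mul, mul_div_cancel₀ _ hn', ofAdd_toAdd]

/-- `ℝ_{≥0}` is perfect: multiplication by `n ≥ 1` is bijective. [cite: MochizukiFrdI2008, §0 p.11] -/
theorem isPerfect_multiplicative_nnreal : IsPerfect (Multiplicative NNReal) := by
  refine ⟨fun n hn => ?_⟩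
  have hn' : (n : NNReal) ≠ 0 := Nat.cast_ne_zero.mpr hn.ne'
  constructor
  · intro x y hxy
    have h : n • Multiplicative.toAdd x = n • Multiplicative.toAdd y := by
      rw [← toAdd_pow, ← toAdd_pow]; exact congrArg _ hxy
    rw [nsmul_eq_mul, nsmul_eq_mul] at h
    exact Multiplicative.toAdd.injective (mul_left_cancel₀ hn' h)
  · intro y
    refine ⟨Multiplicative.ofAdd (Multiplicative.toAdd y / n), ?_⟩
    dsimp only
    rw [← ofAdd_nsmul, nsmul_eq_mul, mul_div_cancel₀ _ hn', ofAdd_toAdd]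

variable {N : Type u} [CommMonoid N]

/-- A monoid isomorphic to the perfect monoid `ℚ_{≥0}` is perfect. [cite: MochizukiFrdI2008, §0 p.11] -/
theorem isPerfect_of_mulEquiv_nnrat (e : N ≃* Multiplicative ℚ≥0) : IsPerfect N :=
  ⟨fun n hn => by
    have hcomm : (fun a : N => a ^ n) = e.symm ∘ (fun b : Multiplicative ℚ≥0 => b ^ n) ∘ e := by
      funext a
      simp [map_pow]
    rw [hcomm]
    exact e.symm.bijective.comp ((isPerfect_multiplicative_nnrat.1 n hn).comp e.bijective)⟩

/-- A monoid isomorphic to the perfect monoid `ℝ_{≥0}` is perfect. [cite: MochizukiFrdI2008, §0 p.11] -/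
theorem isPerfect_of_mulEquiv_nnreal (e : N ≃* Multiplicative NNReal) : IsPerfect N :=
  ⟨fun n hn => by
    have hcomm : (fun a : N => a ^ n) = e.symm ∘ (fun b : Multiplicative NNReal => b ^ n) ∘ e := by
      funext a
      simp [map_pow]
    rw [hcomm]
    exact e.symm.bijective.comp ((isPerfect_multiplicative_nnreal.1 n hn).comp e.bijective)⟩

/-- For `e : N ≅ ℤ_{≥0}`, the value `e(a)/n ∈ ℚ_{≥0}` of the class `a^{1/n}` of `N^pf`.
[cite: MochizukiFrdI2008, §0 p.11] -/
def zPerfectionVal (e : N ≃* Multiplicative ℕ) (x : N × ℕ+) : Multiplicative ℚ≥0 :=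
  Multiplicative.ofAdd (((Multiplicative.toAdd (e x.1) : ℕ) : ℚ≥0) / (x.2 : ℕ))

/-- `zPerfectionVal` respects the relation defining the perfection. [cite: MochizukiFrdI2008, §0 p.11] -/
theorem zPerfectionVal_wd (e : N ≃* Multiplicative ℕ) (x y : N × ℕ+) (h : PerfectionRel N x y) :
    zPerfectionVal e x = zPerfectionVal e y := by
  obtain ⟨K, hK⟩ := h
  have hK' : (K : ℕ) * (y.2 : ℕ) * (Multiplicative.toAdd (e x.1) : ℕ) =
      (K : ℕ) * (x.2 : ℕ) * (Multiplicative.toAdd (e y.1) : ℕ) := by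
    have := congrArg (fun z => (Multiplicative.toAdd (e z) : ℕ)) hK
    simpa only [map_pow, toAdd_pow, smul_eq_mul] using this
  have h2 : (y.2 : ℕ) * (Multiplicative.toAdd (e x.1) : ℕ) = (x.2 : ℕ) * (Multiplicative.toAdd (e y.1) : ℕ) := by
    rw [mul_assoc, mul_assoc] at hK'
    exact Nat.eq_of_mul_eq_mul_left K.pos hK'
  unfold zPerfectionVal
  congr 1
  rw [div_eq_div_iff (Nat.cast_ne_zero.mpr x.2.pos.ne') (Nat.cast_ne_zero.mpr y.2.pos.ne'),
    mul_comm, ← Nat.cast_mul, h2, Nat.cast_mul, mul_comm]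

/-- For `e : N ≅ ℤ_{≥0}`, the homomorphism `N^pf → ℚ_{≥0}`, `a^{1/n} ↦ e(a)/n`.
[cite: MochizukiFrdI2008, §0 p.11] -/
def zPerfectionHom (e : N ≃* Multiplicative ℕ) : Perfection N →* Multiplicative ℚ≥0 where
  toFun := Quotient.lift (zPerfectionVal e) (zPerfectionVal_wd e)
  map_one' := by
    show zPerfectionVal e (1, 1) = 1
    simp [zPerfectionVal]
  map_mul' x y := by
    obtain ⟨⟨a, n⟩, rfl⟩ := Perfection.mk_surjective x
    obtain ⟨⟨b, m⟩, rfl⟩ := Perfection.mk_surjective y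
    show zPerfectionVal e (a ^ (m : ℕ) * b ^ (n : ℕ), n * m) = zPerfectionVal e (a, n) * zPerfectionVal e (b, m)
    unfold zPerfectionVal
    rw [← ofAdd_add]
    congr 1
    dsimp only
    rw [map_mul, map_pow, map_pow, toAdd_mul, toAdd_pow, toAdd_pow, smul_eq_mul, smul_eq_mul,
      PNat.mul_coe, Nat.cast_add, Nat.cast_mul, Nat.cast_mul, Nat.cast_mul,
      div_add_div _ _ (Nat.cast_ne_zero.mpr n.pos.ne') (Nat.cast_ne_zero.mpr m.pos.ne')]
    congr 1
    ring

/-- `zPerfectionHom` on classes. [cite: MochizukiFrdI2008, §0 p.11] -/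
theorem zPerfectionHom_mk (e : N ≃* Multiplicative ℕ) (a : N) (n : ℕ+) :
    zPerfectionHom e (Perfection.mk a n) =
      Multiplicative.ofAdd (((Multiplicative.toAdd (e a) : ℕ) : ℚ≥0) / (n : ℕ)) := rfl

/-- `zPerfectionHom` is bijective. [cite: MochizukiFrdI2008, §0 p.11] -/
theorem zPerfectionHom_bijective (e : N ≃* Multiplicative ℕ) : Bijective (zPerfectionHom e) := by
  constructor
  · intro x y hxy
    obtain ⟨⟨a, n⟩, rfl⟩ := Perfection.mk_surjective x
    obtain ⟨⟨b, m⟩, rfl⟩ := Perfection.mk_surjective y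
    change zPerfectionVal e (a, n) = zPerfectionVal e (b, m) at hxy
    unfold zPerfectionVal at hxy
    have h := Multiplicative.ofAdd.injective hxy
    dsimp only at h
    rw [div_eq_div_iff (Nat.cast_ne_zero.mpr n.pos.ne') (Nat.cast_ne_zero.mpr m.pos.ne'),
      ← Nat.cast_mul, ← Nat.cast_mul, Nat.cast_inj] at h
    refine Perfection.mk_eq_mk_iff.mpr ⟨1, e.injective ?_⟩
    apply Multiplicative.toAdd.injective
    dsimp only
    simpa only [map_pow, toAdd_pow, smul_eq_mul, PNat.one_coe, one_mul, mul_comm] using h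
  · intro q
    refine ⟨Perfection.mk (e.symm (Multiplicative.ofAdd (Multiplicative.toAdd q).num))
      ⟨(Multiplicative.toAdd q).den, (Multiplicative.toAdd q).den_pos⟩, ?_⟩
    rw [zPerfectionHom_mk, e.apply_symm_apply, toAdd_ofAdd, PNat.mk_coe, NNRat.num_div_den, ofAdd_toAdd]

/-- **`N^pf ≅ ℚ_{≥0}` for a `ℤ`-monoprime `N`** (`(ℤ_{≥0})^pf = ℚ_{≥0}`): `a^{1/n} ↦ e(a)/n`.
[cite: MochizukiFrdI2008, §0 p.11] -/
def zPerfectionEquiv (e : N ≃* Multiplicative ℕ) : Perfection N ≃* Multiplicative ℚ≥0 :=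
  MulEquiv.ofBijective (zPerfectionHom e) (zPerfectionHom_bijective e)

/-- The perfection of a `ℤ`-monoprime monoid is `ℚ`-monoprime: `(ℤ_{≥0})^pf ≅ ℚ_{≥0}`.
[cite: MochizukiFrdI2008, §0 p.11] -/
theorem IsZMonoprime.perfection (h : IsZMonoprime N) : IsQMonoprime (Perfection N) := by
  obtain ⟨⟨e⟩⟩ := h
  exact ⟨⟨zPerfectionEquiv e⟩⟩

/-- The perfection of a `ℚ`-monoprime monoid is `ℚ`-monoprime (`ℚ_{≥0}` is perfect).
[cite: MochizukiFrdI2008, §0 p.11] -/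
theorem IsQMonoprime.perfection (h : IsQMonoprime N) : IsQMonoprime (Perfection N) := by
  obtain ⟨⟨e⟩⟩ := h
  exact ⟨⟨(isPerfect_of_mulEquiv_nnrat e).equivPerfection.symm.trans e⟩⟩

/-- The perfection of an `ℝ`-monoprime monoid is `ℝ`-monoprime (`ℝ_{≥0}` is perfect).
[cite: MochizukiFrdI2008, §0 p.11] -/
theorem IsRMonoprime.perfection (h : IsRMonoprime N) : IsRMonoprime (Perfection N) := by
  obtain ⟨⟨e⟩⟩ := h
  exact ⟨⟨(isPerfect_of_mulEquiv_nnreal e).equivPerfection.symm.trans e⟩⟩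

/-- The perfection of a monoprime monoid is monoprime. [cite: MochizukiFrdI2008, §0 p.11] -/
theorem IsMonoprime.perfection (h : IsMonoprime N) : IsMonoprime (Perfection N) := by
  cases h with
  | ofZ h => exact IsMonoprime.ofQ h.perfection
  | ofQ h => exact IsMonoprime.ofQ h.perfection
  | ofR h => exact IsMonoprime.ofR h.perfection

end MonoprimePerfection

/-! ### The standing situation of Def. 2.4 (i): every `(M^pf)_𝔮` monoprime, every `M^rlf_𝔮` `ℝ`-monoprime -/

/-- If `M` is sharp and every `M_𝔭` (`𝔭 ∈ Prime(M)`) is monoprime, then every `(M^pf)_𝔮`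
(`𝔮 ∈ Prime(M^pf)`) is monoprime (`(M^pf)_𝔮 ≅ (M_𝔭)^pf`). [cite: MochizukiFrdI2008, Def. 2.4(i) p.47] -/
theorem isMonoprime_submonoid_primes_perfection (hM : IsSharp M)
    (hmono : ∀ 𝔭 : Primes M, IsMonoprime ↥𝔭.submonoid) (𝔮 : Primes (Perfection M)) :
    IsMonoprime ↥𝔮.submonoid :=
  (hmono ((Primes.perfectionEquiv hM).symm 𝔮)).perfection.of_mulEquiv
    (Primes.perfectionSubmonoidEquiv hM _ 𝔮 ((Primes.perfectionEquiv hM).apply_symm_apply 𝔮))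

/-- Under the same hypotheses every `M^rlf_𝔮 := (M^pf)_𝔮 ⊗ ℝ_{≥0}` is `ℝ`-monoprime (so that the
suprema in Def. 2.4 (i)(c) exist and are unique, §0 p. 12). [cite: MochizukiFrdI2008, Def. 2.4(i) p.47] -/
theorem isRMonoprime_realification_submonoid_primes_perfection (hM : IsSharp M)
    (hmono : ∀ 𝔭 : Primes M, IsMonoprime ↥𝔭.submonoid) (𝔮 : Primes (Perfection M)) :
    IsRMonoprime (Realification ↥𝔮.submonoid) :=
  isRMonoprime_realification (isMonoprime_submonoid_primes_perfection hM hmono 𝔮)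

end Literature.AlgebraicGeometry.Frobenioids
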